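import Literature.Analysis.FluidPDE.TsaiTopSingularNullHolds
import Literature.Analysis.FluidPDE.LocalTypeISlabProfile
import Literature.Analysis.FluidPDE.PineauVicolRSSProofs
import Summits.NavierStokesRegularity.NavierStokesRegularity.Theorems.AdaptedFrequencyFrequencyRigidityClassicalSuitableSlab
import HarnessLib

/-!
# Crux `FrequencyRigidity` (stmt-NavierStokesRegularity-2955), line `scaled-energy-split`:
# RSS witnesses of the finite piece have Pineau–Vicol-decaying profiles (Tsai 1998 §4 for RSS)

Helper file (`--supports stmt-NavierStokesRegularity-2955`; theorems only, sorry-free).  Stub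
`stub_finiteRSSProfileDecay` (sub-goal (A) of Stub 2): a classical unit-viscosity Navier–Stokes
flow on `(−∞,0)` of ROTATED self-similar form `u(t,x) = (−t)^{−1/2} R(αs) U(R(−αs)x/√(−t))`,
`s = −log(−t)` (Pineau–Vicol 2026 (1.7), the tree's `pvAnsatz α (fun y _ => U y)`), whose
Albritton–Barker quantity `𝐈(ℝ³ × ℝ₋)` is finite, has a profile with the pointwise decay
`‖U(y)‖ ≤ C₀/(1 + ‖y‖)` — Pineau–Vicol's Type I hypothesis (1.9) = (1.10).

Proof (Tsai 1998, Cor. 4.3, transplanted from rays to spirals).  If `U ≢ 0` the vertex `(0,0)`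
is backward-singular, so by the tree's packaging `isLocalTypeISingularPoint_of_slabProfile`
(classical ⇒ suitable on the slab, `stub_classicalSuitableSlab`; pressure normalised by its
unit-ball mean) the flow is a suitable weak solution in the unit parabolic ball in CKN's class on
the whole ball, and Tsai's Lemma 4.2 remark (`tsai1998_top_singular_null_holds`, PROVED in the
tree from CKN–Lin ε-regularity) makes the top singular set `{x ∈ B₁ : (0,x) singular}`
`μH[1]`-null.  If the profile did not decay, `‖yₖ‖‖U(yₖ)‖ → ∞` along `‖yₖ‖ → ∞`; the ROTATED
directions `dₖ = R(2α log‖yₖ‖)(yₖ/‖yₖ‖)` accumulate at some unit vector `e`, and the self-similar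
points `(−σ²/‖yₖ‖², σ R(−2α log σ) dₖ)`, at which `‖u‖ = ‖yₖ‖‖U(yₖ)‖/σ`, show that every point of
the SPIRAL `σ ↦ σ R(−2α log σ) e`, `0 < σ < 1`, is backward-singular at `t = 0`.  The norm map is
`1`-Lipschitz and sends the spiral onto `(0,1)`, so the spiral has `μH[1]`-measure `≥ 1`
(`LipschitzWith.hausdorffMeasure_image_le`, `hausdorffMeasure_real`) — a contradiction.  For
`α = 0` the spiral is Tsai's segment.

## References

* T.-P. Tsai, *On Leray's self-similar solutions of the Navier–Stokes equations satisfying local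
  energy estimates*, Arch. Rational Mech. Anal. 143 (1998) 29–51: Lemma 4.2 and the remark after
  it, Corollary 4.3 (pp. 46–47). [Tsai1998]
* B. Pineau, V. Vicol, arXiv:2607.09619 (2026), (1.7), (1.9)–(1.10), Remark 1.2. [PineauVicol2026]
* D. Albritton, T. Barker, J. Math. Fluid Mech. 21 (2019) = arXiv:1811.00502, §1, Def. 2.1.
  [AlbrittonBarker2019]
-/

noncomputable section

set_option linter.dupNamespace false

namespace Summit.NavierStokesRegularity.NavierStokesRegularity.Theorems.FrequencyRigidity.ScaledEnergySplit

open Literature.Analysis.FluidPDE MeasureTheory Set Function Metric Filter Topology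
open scoped ENNReal NNReal

/-! ## The RSS field at self-similar points -/

/-- **The RSS field along a similarity spiral.**  For `y ≠ 0`, `σ > 0`, at the time
`t = −(σ/‖y‖)²` and the point `x = (σ/‖y‖) R(θ) y`, `θ = α(−log(−t))`, the field
`pvAnsatz α U` takes the value `(‖y‖/σ) R(θ) U(y)`; in particular its norm is `‖y‖‖U(y)‖/σ`.
[cite: PineauVicol2026, (1.7) (arXiv:2607.09619 p. 3)] -/
theorem rssDecay_norm_pvAnsatz_spiral (α : ℝ) (U : EuclideanSpace ℝ (Fin 3) → EuclideanSpace ℝ (Fin 3))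
    {y : EuclideanSpace ℝ (Fin 3)} (hy : y ≠ 0) {σ : ℝ} (hσ : 0 < σ) :
    ‖pvAnsatz α (fun z _ => U z) (-(σ / ‖y‖) ^ 2)
        ((σ / ‖y‖) • rotZ (α * -Real.log (-(-(σ / ‖y‖) ^ 2))) y)‖ = ‖y‖ * ‖U y‖ / σ := by
  have hy0 : 0 < ‖y‖ := norm_pos_iff.2 hy
  have hL : 0 < σ / ‖y‖ := div_pos hσ hy0
  have hsqrt : Real.sqrt (-(-(σ / ‖y‖) ^ 2)) = σ / ‖y‖ := by
    rw [neg_neg, Real.sqrt_sq hL.le]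
  rw [PineauVicol2026.norm_pvAnsatz, hsqrt, inv_smul_smul₀ hL.ne', ← rotZ_add, neg_add_cancel,
    rotZ_zero]
  field_simp

/-- The spiral point rewritten: `(σ/‖y‖) R(θ) y = σ R(−2α log σ) (R(2α log‖y‖)(y/‖y‖))` with
`θ = α(−log((σ/‖y‖)²)) = −2α log σ + 2α log‖y‖`. [folklore] -/
theorem rssDecay_spiral_point_eq (α : ℝ) {y : EuclideanSpace ℝ (Fin 3)} (hy : y ≠ 0) {σ : ℝ}
    (hσ : 0 < σ) :
    (σ / ‖y‖) • rotZ (α * -Real.log (-(-(σ / ‖y‖) ^ 2))) y =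
      σ • rotZ (-(2 * α * Real.log σ)) (rotZ (2 * α * Real.log ‖y‖) (‖y‖⁻¹ • y)) := by
  have hy0 : 0 < ‖y‖ := norm_pos_iff.2 hy
  have hθ : α * -Real.log (-(-(σ / ‖y‖) ^ 2)) = -(2 * α * Real.log σ) + 2 * α * Real.log ‖y‖ := by
    rw [neg_neg, Real.log_pow, Real.log_div hσ.ne' hy0.ne']
    push_cast
    ring
  rw [hθ, rotZ_add,
    show rotZ (2 * α * Real.log ‖y‖) (‖y‖⁻¹ • y) = ‖y‖⁻¹ • rotZ (2 * α * Real.log ‖y‖) y by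
      rw [← rotZL_apply, map_smul, rotZL_apply],
    show rotZ (-(2 * α * Real.log σ)) (‖y‖⁻¹ • rotZ (2 * α * Real.log ‖y‖) y) =
        ‖y‖⁻¹ • rotZ (-(2 * α * Real.log σ)) (rotZ (2 * α * Real.log ‖y‖) y) by
      rw [← rotZL_apply (-(2 * α * Real.log σ)), map_smul, rotZL_apply],
    smul_smul, div_eq_mul_inv]

/-! ## Singular points of the RSS flow -/

variable {α : ℝ} {U : EuclideanSpace ℝ (Fin 3) → EuclideanSpace ℝ (Fin 3)}
  {u : ℝ → EuclideanSpace ℝ (Fin 3) → EuclideanSpace ℝ (Fin 3)}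
  {p : ℝ → EuclideanSpace ℝ (Fin 3) → ℝ}

/-- Continuity of a classical solution below the final time, at a space–time point. [folklore] -/
theorem rssDecay_continuousAt (hsol : IsClassicalNSSolutionOn (Iio (0 : ℝ)) 1 0 u p) {t : ℝ}
    (ht : t < 0) (x : EuclideanSpace ℝ (Fin 3)) : ContinuousAt (uncurry u) (t, x) :=
  hsol.smooth_velocity.continuousOn.continuousAt
    ((isOpen_Iio.prod isOpen_univ).mem_nhds (mk_mem_prod ht (mem_univ x)))

/-- **Every point of the spiral is backward-singular.**  If `u` is the RSS flow on `t < 0` and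
`dₖ = R(2α log‖yₖ‖)(yₖ/‖yₖ‖) → e` along a sequence with `‖yₖ‖ → ∞` and `k < ‖yₖ‖‖U(yₖ)‖`, then
for every `0 < σ` the point `(0, σ R(−2α log σ) e)` is a backward singular point of `u`
(Tsai 1998, proof of Cor. 4.3, with rotated directions). [cite: Tsai1998, Corollary 4.3 (pp. 46–47)] -/
theorem rssDecay_spiral_singular (hsol : IsClassicalNSSolutionOn (Iio (0 : ℝ)) 1 0 u p)
    (hA : ∀ t ∈ Iio (0 : ℝ), ∀ x, u t x = pvAnsatz α (fun z _ => U z) t x)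
    {y : ℕ → EuclideanSpace ℝ (Fin 3)} (hy0 : ∀ k, y k ≠ 0)
    (hnorm : Tendsto (fun k => ‖y k‖) atTop atTop) (hyC : ∀ k : ℕ, (k : ℝ) < ‖y k‖ * ‖U (y k)‖)
    {e : EuclideanSpace ℝ (Fin 3)}
    (hlim : Tendsto (fun k => rotZ (2 * α * Real.log ‖y k‖) (‖y k‖⁻¹ • y k)) atTop (𝓝 e))
    {σ : ℝ} (hσ : 0 < σ) :
    IsBackwardSingularPoint u (0, σ • rotZ (-(2 * α * Real.log σ)) e) := by
  apply isBackwardSingularPoint_of_forall_exists_continuousAt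
  intro r hr M
  set ψ : ℝ := -(2 * α * Real.log σ) with hψ
  -- (i) directions close to `e`
  have h1 : ∀ᶠ k in atTop, ‖rotZ (2 * α * Real.log ‖y k‖) (‖y k‖⁻¹ • y k) - e‖ < r / σ :=
    (tendsto_order.1 (tendsto_iff_norm_sub_tendsto_zero.1 hlim)).2 _ (div_pos hr hσ)
  -- (ii) times in the window `(−r², 0)`
  have h2 : ∀ᶠ k in atTop, (σ / ‖y k‖) ^ 2 < r ^ 2 := by
    have ht : Tendsto (fun k => (σ / ‖y k‖) ^ 2) atTop (𝓝 0) := by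
      have h0 : Tendsto (fun k => σ / ‖y k‖) atTop (𝓝 0) := hnorm.const_div_atTop σ
      simpa using h0.pow 2
    exact (tendsto_order.1 ht).2 _ (by positivity)
  -- (iii) large values
  have h3 : ∀ᶠ k : ℕ in atTop, M * σ ≤ k := by
    obtain ⟨N, hN⟩ := exists_nat_ge (M * σ)
    exact eventually_atTop.2 ⟨N, fun n hn => hN.trans (Nat.cast_le.2 hn)⟩
  obtain ⟨k, hk1, hk2, hk3⟩ := (h1.and (h2.and h3)).exists
  have hyk : 0 < ‖y k‖ := norm_pos_iff.2 (hy0 k)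
  set t : ℝ := -(σ / ‖y k‖) ^ 2 with ht
  have ht0 : t < 0 := by rw [ht]; exact neg_neg_of_pos (by positivity)
  set x : EuclideanSpace ℝ (Fin 3) := (σ / ‖y k‖) • rotZ (α * -Real.log (-t)) (y k) with hx
  have hxeq : x = σ • rotZ ψ (rotZ (2 * α * Real.log ‖y k‖) (‖y k‖⁻¹ • y k)) :=
    rssDecay_spiral_point_eq α (hy0 k) hσ
  refine ⟨(t, x), ?_, rssDecay_continuousAt hsol ht0 x, ?_⟩
  · -- the point lies in `Q_r(0, σ R(ψ) e)`
    rw [mem_parabolicCylinder]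
    refine ⟨⟨by rw [ht]; linarith, ht0⟩, ?_⟩
    show dist x (σ • rotZ ψ e) < r
    rw [hxeq, dist_eq_norm, ← smul_sub,
      show rotZ ψ (rotZ (2 * α * Real.log ‖y k‖) (‖y k‖⁻¹ • y k)) - rotZ ψ e =
          rotZ ψ (rotZ (2 * α * Real.log ‖y k‖) (‖y k‖⁻¹ • y k) - e) by
        rw [← rotZL_apply ψ, ← rotZL_apply ψ, ← rotZL_apply ψ, map_sub],
      norm_smul, norm_rotZ, Real.norm_of_nonneg hσ.le]
    calc σ * ‖rotZ (2 * α * Real.log ‖y k‖) (‖y k‖⁻¹ • y k) - e‖ < σ * (r / σ) :=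
          mul_lt_mul_of_pos_left hk1 hσ
      _ = r := mul_div_cancel₀ _ hσ.ne'
  · -- and `‖u‖ = ‖yₖ‖‖U(yₖ)‖/σ > k/σ ≥ M` there
    show M < ‖u t x‖
    rw [hA t ht0 x, hx, ht, rssDecay_norm_pvAnsatz_spiral α U (hy0 k) hσ, lt_div_iff₀ hσ]
    exact hk3.trans_lt (hyC k)

/-- **The vertex is backward-singular as soon as the profile is not identically zero**: along
`(t, √(−t) R(θ(t)) y₀)`, `t ↑ 0`, the RSS field has norm `‖U(y₀)‖/√(−t) → ∞`. [folklore] -/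
theorem rssDecay_origin_singular (hsol : IsClassicalNSSolutionOn (Iio (0 : ℝ)) 1 0 u p)
    (hA : ∀ t ∈ Iio (0 : ℝ), ∀ x, u t x = pvAnsatz α (fun z _ => U z) t x)
    {y₀ : EuclideanSpace ℝ (Fin 3)} (hy₀ : U y₀ ≠ 0) :
    IsBackwardSingularPoint u 0 := by
  apply isBackwardSingularPoint_of_forall_exists_continuousAt
  intro r hr M
  have hU0 : 0 < ‖U y₀‖ := norm_pos_iff.2 hy₀
  -- choose `s = √(−t)` small: `s < r`, `s ‖y₀‖ < r`, `s M < ‖U y₀‖`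
  obtain ⟨s, hs0, hs1, hs2, hs3⟩ : ∃ s : ℝ, 0 < s ∧ s < r ∧ s * ‖y₀‖ < r ∧ s * max M 0 < ‖U y₀‖ := by
    refine ⟨min (r / 2) (min (r / (2 * (‖y₀‖ + 1))) (‖U y₀‖ / (2 * (max M 0 + 1)))), ?_, ?_, ?_, ?_⟩
    · positivity
    · exact (min_le_left _ _).trans_lt (by linarith)
    · have h1 : min (r / 2) (min (r / (2 * (‖y₀‖ + 1))) (‖U y₀‖ / (2 * (max M 0 + 1)))) ≤
          r / (2 * (‖y₀‖ + 1)) := (min_le_right _ _).trans (min_le_left _ _)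
      have h2 : r / (2 * (‖y₀‖ + 1)) * ‖y₀‖ < r := by
        rw [div_mul_eq_mul_div, div_lt_iff₀ (by positivity)]
        nlinarith [norm_nonneg y₀]
      exact lt_of_le_of_lt (mul_le_mul_of_nonneg_right h1 (norm_nonneg _)) h2
    · have h1 : min (r / 2) (min (r / (2 * (‖y₀‖ + 1))) (‖U y₀‖ / (2 * (max M 0 + 1)))) ≤
          ‖U y₀‖ / (2 * (max M 0 + 1)) := (min_le_right _ _).trans (min_le_right _ _)
      have h2 : ‖U y₀‖ / (2 * (max M 0 + 1)) * max M 0 < ‖U y₀‖ := by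
        rw [div_mul_eq_mul_div, div_lt_iff₀ (by positivity)]
        nlinarith [le_max_right M 0]
      exact lt_of_le_of_lt (mul_le_mul_of_nonneg_right h1 (le_max_right _ _)) h2
  set t : ℝ := -s ^ 2 with ht
  have ht0 : t < 0 := by rw [ht]; exact neg_neg_of_pos (by positivity)
  have hsqrt : Real.sqrt (-t) = s := by rw [ht, neg_neg, Real.sqrt_sq hs0.le]
  set x : EuclideanSpace ℝ (Fin 3) := s • rotZ (α * -Real.log (-t)) y₀ with hx
  refine ⟨(t, x), ?_, rssDecay_continuousAt hsol ht0 x, ?_⟩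
  · rw [mem_parabolicCylinder]
    refine ⟨⟨?_, ht0⟩, ?_⟩
    · show (0 : ℝ × EuclideanSpace ℝ (Fin 3)).1 - r ^ 2 < t
      rw [Prod.fst_zero, ht]
      nlinarith
    · show dist x (0 : ℝ × EuclideanSpace ℝ (Fin 3)).2 < r
      rw [Prod.snd_zero, dist_zero_right, hx, norm_smul, norm_rotZ, Real.norm_of_nonneg hs0.le]
      exact hs2
  · show M < ‖u t x‖
    rw [hA t ht0 x, PineauVicol2026.norm_pvAnsatz, hsqrt, hx, inv_smul_smul₀ hs0.ne', ← rotZ_add,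
      neg_add_cancel, rotZ_zero, lt_inv_mul_iff₀ hs0]
    exact (mul_le_mul_of_nonneg_left (le_max_left M 0) hs0.le).trans_lt hs3

/-! ## The top singular set of a finite-`𝐈` classical flow is `μH[1]`-null -/

/-- **Tsai's Lemma 4.2 remark for classical flows with `𝐈 < ∞` and a singular vertex.**  A
classical solution (`ν = 1`) on `(−∞,0)` with finite Albritton–Barker quantity and backward-singular
origin is, with the pressure normalised by its unit-ball mean, a local Type I singular point
(`isLocalTypeISingularPoint_of_slabProfile` over `stub_classicalSuitableSlab`), in particular a
suitable weak solution in `Q((0,0),1)` in CKN's class on the whole ball; hence the set of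
`x ∈ B(0,1)` with `(0,x)` backward-singular is `μH[1]`-null (`tsai1998_top_singular_null_holds`).
[cite: Tsai1998, Lemma 4.2 and the following remark (p. 46)] -/
theorem rssDecay_topSingular_null (hsol : IsClassicalNSSolutionOn (Iio (0 : ℝ)) 1 0 u p)
    (hI : typeIBound (Iio (0 : ℝ) ×ˢ univ) u p (fun t x => fderiv ℝ (u t) x) < ⊤)
    (hsing : IsBackwardSingularPoint u 0) :
    μH[1] {x ∈ ball (0 : EuclideanSpace ℝ (Fin 3)) 1 | IsBackwardSingularPoint u (0, x)} = 0 := by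
  obtain ⟨hsw, hwg⟩ := stub_classicalSuitableSlab u p hsol
  obtain ⟨-, ⟨hswQ, ⟨C, hC⟩, hgrad, hp'⟩, -, -⟩ :=
    isLocalTypeISingularPoint_of_slabProfile hsw hwg hI hsing
  obtain ⟨h32, h32', h32r⟩ := threeHalves_facts
  have hfin := hp'.eLpNorm_lt_top
  rw [eLpNorm_eq_lintegral_rpow_enorm_toReal (zero_lt_one.trans_le h32).ne' h32', h32r] at hfin
  have hp : ∫⁻ z in parabolicCylinder 1 (0 : ℝ × EuclideanSpace ℝ (Fin 3)),
      ‖(fun t x => p t x - ⨍ y in ball (0 : EuclideanSpace ℝ (Fin 3)) 1, p t y) z.1 z.2‖ₑ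
        ^ (3 / 2 : ℝ) < ∞ :=
    (ENNReal.rpow_lt_top_iff_of_pos (by norm_num : (0:ℝ) < 1 / (3 / 2))).1 hfin
  have henergy : ∃ C : ℝ≥0, ∀ᵐ t : ℝ, t ∈ Ioo ((0:ℝ) - 1 ^ 2) 0 →
      ∫⁻ x in ball (0 : EuclideanSpace ℝ (Fin 3)) 1, ‖u t x‖ₑ ^ 2 ≤ C := by
    refine ⟨C, ?_⟩
    have hC' : ∀ᵐ t ∂(volume.restrict (Ioo ((0:ℝ) - 1 ^ 2) 0)),
        ∫⁻ x in ball (0 : EuclideanSpace ℝ (Fin 3)) 1, ‖u t x‖ₑ ^ 2 ≤ C := by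
      simpa using hC
    exact (ae_restrict_iff' measurableSet_Ioo).1 hC'
  exact tsai1998_top_singular_null_holds one_pos one_pos hswQ henergy hgrad hp

/-! ## The Hausdorff measure of the spiral -/

/-- **The spiral has one-dimensional Hausdorff measure at least `1`.**  For a unit vector `e`
the norm map (1-Lipschitz, `LipschitzWith.hausdorffMeasure_image_le`) sends the spiral
`{σ R(−2α log σ) e : 0 < σ < 1}` onto `(0,1)`, whose `μH[1]`-measure is its length
(`hausdorffMeasure_real`). [folklore] -/
theorem rssDecay_one_le_hausdorffMeasure_spiral (α : ℝ) {e : EuclideanSpace ℝ (Fin 3)} (he : ‖e‖ = 1) :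
    1 ≤ μH[1] ((fun σ : ℝ => σ • rotZ (-(2 * α * Real.log σ)) e) '' Ioo (0 : ℝ) 1) := by
  set T := (fun σ : ℝ => σ • rotZ (-(2 * α * Real.log σ)) e) '' Ioo (0 : ℝ) 1 with hT
  have himage : (fun v : EuclideanSpace ℝ (Fin 3) => ‖v‖) '' T = Ioo (0 : ℝ) 1 := by
    ext s
    simp only [hT, mem_image, exists_exists_and_eq_and, norm_smul, norm_rotZ, he, mul_one,
      Real.norm_eq_abs]
    constructor
    · rintro ⟨σ, hσ, rfl⟩
      rwa [abs_of_pos hσ.1]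
    · intro hs
      exact ⟨s, hs, abs_of_pos hs.1⟩
  have hLip : LipschitzWith 1 fun v : EuclideanSpace ℝ (Fin 3) => ‖v‖ := lipschitzWith_one_norm
  have hle := hLip.hausdorffMeasure_image_le (d := 1) zero_le_one T
  rw [himage, ENNReal.coe_one, ENNReal.one_rpow, one_mul] at hle
  have hvol : μH[1] (Ioo (0 : ℝ) 1) = 1 := by
    rw [hausdorffMeasure_real, Real.volume_Ioo, sub_zero, ENNReal.ofReal_one]
  rw [hvol] at hle
  exact hle

/-! ## Decay of the profile -/

/-- **Tsai's Corollary 4.3 for rotated self-similar flows in the Albritton–Barker class**: the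
profile satisfies `‖y‖‖U(y)‖ ≤ C` for `‖y‖ ≥ R`.  Otherwise the spiral of singular top points
built from a non-decay sequence has positive `μH[1]`-measure inside the `μH[1]`-null top singular
set of the unit parabolic ball. [cite: Tsai1998, Corollary 4.3 (pp. 46–47)] -/
theorem rssDecay_exists_bound (hsol : IsClassicalNSSolutionOn (Iio (0 : ℝ)) 1 0 u p)
    (hA : ∀ t ∈ Iio (0 : ℝ), ∀ x, u t x = pvAnsatz α (fun z _ => U z) t x)
    (hI : typeIBound (Iio (0 : ℝ) ×ˢ univ) u p (fun t x => fderiv ℝ (u t) x) < ⊤) :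
    ∃ C R : ℝ, ∀ y, R ≤ ‖y‖ → ‖y‖ * ‖U y‖ ≤ C := by
  by_contra hcon
  push Not at hcon
  choose y hyR hyC using fun k : ℕ => hcon k (k + 1)
  have hy0 : ∀ k, 0 < ‖y k‖ := fun k => lt_of_lt_of_le (by positivity) (hyR k)
  have hy0' : ∀ k, y k ≠ 0 := fun k => norm_pos_iff.1 (hy0 k)
  -- the profile is not identically zero, so the vertex is singular and Tsai's lemma applies
  have hU0 : U (y 0) ≠ 0 := by
    intro h
    have := hyC 0
    rw [h, norm_zero, mul_zero] at this
    exact absurd this (by norm_num)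
  have hnull := rssDecay_topSingular_null hsol hI (rssDecay_origin_singular hsol hA hU0)
  -- rotated directions accumulate on the unit sphere
  have hd1 : ∀ k, rotZ (2 * α * Real.log ‖y k‖) (‖y k‖⁻¹ • y k) ∈ sphere (0 : EuclideanSpace ℝ (Fin 3)) 1 := by
    intro k
    rw [mem_sphere_zero_iff_norm, norm_rotZ]
    exact norm_smul_inv_norm (hy0' k)
  obtain ⟨e, he, φ, hφ, hlim⟩ := (isCompact_sphere (0 : EuclideanSpace ℝ (Fin 3)) 1).tendsto_subseq hd1
  have he1 : ‖e‖ = 1 := mem_sphere_zero_iff_norm.1 he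
  have hnorm : Tendsto (fun n => ‖y (φ n)‖) atTop atTop := by
    refine tendsto_atTop_mono (fun n => ?_) tendsto_natCast_atTop_atTop
    calc (n : ℝ) ≤ φ n := Nat.cast_le.2 (hφ.id_le n)
      _ ≤ φ n + 1 := by linarith
      _ ≤ ‖y (φ n)‖ := hyR (φ n)
  have hyC' : ∀ n : ℕ, (n : ℝ) < ‖y (φ n)‖ * ‖U (y (φ n))‖ := fun n =>
    lt_of_le_of_lt (Nat.cast_le.2 (hφ.id_le n)) (hyC (φ n))
  -- every point of the spiral is a singular top point inside `B(0,1)`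
  have hsub : (fun σ : ℝ => σ • rotZ (-(2 * α * Real.log σ)) e) '' Ioo (0 : ℝ) 1 ⊆
      {x ∈ ball (0 : EuclideanSpace ℝ (Fin 3)) 1 | IsBackwardSingularPoint u (0, x)} := by
    rintro _ ⟨σ, hσ, rfl⟩
    refine ⟨?_, rssDecay_spiral_singular hsol hA (fun n => hy0' (φ n)) hnorm hyC' hlim hσ.1⟩
    rw [mem_ball_zero_iff, norm_smul, norm_rotZ, Real.norm_of_nonneg hσ.1.le, he1, mul_one]
    exact hσ.2
  have hle := (rssDecay_one_le_hausdorffMeasure_spiral α he1).trans (measure_mono (μ := μH[1]) hsub)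
  rw [hnull] at hle
  exact absurd hle (by norm_num)

/-- The profile is the time-`−1` slice of the flow: `U = u(−1, ·)`; in particular it is
continuous. [cite: PineauVicol2026, Remark 1.3 (p. 4)] -/
theorem rssDecay_profile_continuous (hsol : IsClassicalNSSolutionOn (Iio (0 : ℝ)) 1 0 u p)
    (hA : ∀ t ∈ Iio (0 : ℝ), ∀ x, u t x = pvAnsatz α (fun z _ => U z) t x) : Continuous U := by
  have hm1 : (-1 : ℝ) ∈ Iio (0 : ℝ) := by norm_num
  have hU : U = u (-1) := by
    funext x
    rw [hA (-1) hm1 x, pvAnsatz_neg_one]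
  rw [hU]
  exact (hsol.contDiff_velocity hm1).continuous

/-- From `‖y‖‖U(y)‖ ≤ C` for `‖y‖ ≥ R` and continuity of `U` to Pineau–Vicol's decay
`‖U(y)‖ ≤ C₀/(1 + ‖y‖)` with some `C₀ > 0`. [cite: PineauVicol2026, Remark 1.2 (pp. 3–4)] -/
theorem rssDecay_decay_of_bound (hU : Continuous U) {C R : ℝ}
    (h : ∀ y, R ≤ ‖y‖ → ‖y‖ * ‖U y‖ ≤ C) :
    ∃ C₀ : ℝ, 0 < C₀ ∧ ∀ y, ‖U y‖ ≤ C₀ / (1 + ‖y‖) := by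
  set R' : ℝ := max R 1 with hR'
  obtain ⟨M, hM⟩ := (isCompact_closedBall (0 : EuclideanSpace ℝ (Fin 3)) R').exists_bound_of_continuousOn
    hU.continuousOn
  have hM0 : 0 ≤ M := (norm_nonneg _).trans (hM 0 (mem_closedBall_self (by positivity)))
  refine ⟨2 * max C 0 + M * (1 + R') + 1, by positivity, fun y => ?_⟩
  rw [le_div_iff₀ (by positivity)]
  by_cases hy : R' ≤ ‖y‖
  · -- far: `‖U y‖(1 + ‖y‖) ≤ 2‖y‖‖U y‖ ≤ 2C`
    have h1 : 1 ≤ ‖y‖ := (le_max_right R 1).trans hy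
    have h2 : ‖y‖ * ‖U y‖ ≤ max C 0 := (h y ((le_max_left R 1).trans hy)).trans (le_max_left _ _)
    nlinarith [norm_nonneg (U y), norm_nonneg y, mul_nonneg hM0 (by positivity : (0:ℝ) ≤ 1 + R'),
      le_max_right C 0]
  · -- near: `‖U y‖ ≤ M`
    have hyR : ‖y‖ ≤ R' := (not_le.1 hy).le
    have h1 : ‖U y‖ ≤ M := hM y (mem_closedBall_zero_iff.2 hyR)
    have hR'0 : 0 ≤ R' := le_trans zero_le_one (le_max_right R 1)
    nlinarith [norm_nonneg (U y), norm_nonneg y, le_max_right C 0, mul_le_mul h1 (show 1 + ‖y‖ ≤ 1 + R' by linarith) (by positivity) hM0]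

/-- **Sub-goal (A) of Stub 2 of line `scaled-energy-split` — RSS witnesses of the finite piece have
Pineau–Vicol-decaying profiles.**  A classical unit-viscosity Navier–Stokes flow on `(−∞,0)` of
rotated self-similar form `u = pvAnsatz α U` with finite Albritton–Barker quantity
`𝐈(ℝ³ × ℝ₋) < ∞` has `‖U(y)‖ ≤ C₀/(1 + ‖y‖)` for some `C₀ > 0` (Tsai 1998 §4 for `α = 0`; the
spiral version for `α ≠ 0`). [cite: Tsai1998, Corollary 4.3 (pp. 46–47); PineauVicol2026, Remark 1.2] -/
theorem stub_finiteRSSProfileDecay : ∀ (α : ℝ) (U : EuclideanSpace ℝ (Fin 3) → EuclideanSpace ℝ (Fin 3)) (u : ℝ → EuclideanSpace ℝ (Fin 3) → EuclideanSpace ℝ (Fin 3)) (p : ℝ → EuclideanSpace ℝ (Fin 3) → ℝ), Literature.Analysis.FluidPDE.IsClassicalNSSolutionOn (Set.Iio 0) 1 0 u p → (∀ t ∈ Set.Iio (0:ℝ), ∀ x, u t x = Literature.Analysis.FluidPDE.pvAnsatz α (fun y _ => U y) t x) → Literature.Analysis.FluidPDE.typeIBound (Set.Iio (0:ℝ) ×ˢ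 Set.univ) u p (fun t x => fderiv ℝ (u t) x) < ⊤ → ∃ C₀ : ℝ, 0 < C₀ ∧ ∀ y, ‖U y‖ ≤ C₀ / (1 + ‖y‖) := by
  intro α U u p hsol hA hI
  obtain ⟨C, R, h⟩ := rssDecay_exists_bound hsol hA hI
  exact rssDecay_decay_of_bound (rssDecay_profile_continuous hsol hA) h

end Summit.NavierStokesRegularity.NavierStokesRegularity.Theorems.FrequencyRigidity.ScaledEnergySplit

end
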